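import Literature.IUT.LogVolume.SubThetaFieldUnramified
import Literature.IUT.LogVolume.Corollary22ThetaClosureField
import Literature.NumberTheory.GaloisRepresentations.InertiaFixesSquareRootsProofs
import Literature.NumberTheory.EllipticCurves.DivisionFieldRamificationSquarefreeProofs
import HarnessLib

/-!
# The ramification of a field pinned by the v3 Θ-datum is BOUNDED BY `46080` at every odd place
# ([IUTchIV] Thm. 1.10 Step (iii) (R2)/(R3) budget for the cell's reading v3; proof-only; abc-iut-S1)

Mochizuki, *Inter-universal Teichmüller theory IV* (RIMS manuscript Apr. 2020 = PRIMS **57** (2021)), Thm. 1.10, Step (ii)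
p. 24: "`Gal(F/F_tpd) ↪ GL₂(𝔽₃) × GL₂(𝔽₅) × ℤ/2ℤ`" (so `e_v ≤ [F : F_tpd] ≤ 2·48·480 = 46080` in the layer `F/F_tpd`), consumed
by Step (iii) (R2)/(R3)/(R4) p. 25–26 ("`log(e_v) ≤ log(2^11·3^3·5·e_mod·l)` …; (R4) if `e_v ≥ p_v − 1 > p_v − 2`, then
`p_v ≤ e*_mod·l`").

In the cell's MODEL READING v3 (abc-iut-plan 2026-08-26T02:33:05Z) the field of the Θ-datum is pinned by
`Cor22.IsSubThetaField P F`: `F ⊆ F‡(P) = F_tpd(√−1, √λ, √(λ−1), E_λ[3·5])`, whose DEGREE over `F_tpd` may reach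
`2²·46080` — too large for print's budget by a factor `4`. This file recovers print's per-place budget at every place of
ODD residue characteristic (the only places where (R4)'s void branch `p > e*_mod·l` needs it), at the INERTIA level:

* `Cor22.sqrtFixer_mul_inf_le` — fixing all square roots of `a·b` and of `a ≠ 0` fixes all square roots of `b`;
* `Cor22.relIndex_sqrtFixer_inf_le_two` — for `c ∈ {λ, λ−1, λ(λ−1)}` and any subgroup `A ≤ sqrtFixer c`, the pair
  `sqrtFixer λ ⊓ sqrtFixer (λ−1)` has relative index `≤ 2` in `A`;
* **`Cor22.ramificationIdx_subThetaField_le`** — for `P ∈ U`, `F` Galois over `F_tpd` with `IsSubThetaField P F`, and a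
  place `w` of `F` over a place `v ∤ 2` of `F_tpd`: **`e(w | v) ≤ 46080`**. PROOF: the absolute inertia group `I_𝔓`
  at `v` fixes the square roots of `−1` (roots of unity of order `4`, `v ∤ 2`; the tree's
  `smul_eq_of_mem_inertia_of_pow_eq_one`) and of the element `c ∈ {λ, λ−1, λ(λ−1)}` of EVEN `v`-order (abc-iut-L5-t15's
  `exists_valuation_eq_exp_two_mul`, `smul_eq_of_mem_inertia_of_sq_eq_of_valuation_eq_exp_even`), so `I_𝔓 ≤ A :=
  sqrtFixer(−1) ⊓ sqrtFixer(c)`; `e(w|v)` is the order of the inertia group of `Gal(F/F_tpd)` (Mathlib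
  `Ideal.card_inertia_eq_ramificationIdxIn`), which is covered by the restriction of `I_𝔓` (the tree's
  `exists_mem_inertia_restrict_eq`), hence by the restriction of `A`, of order `[A : A ∩ Gal(F̄/F)] ≤
  [A : A ∩ (ker ρ̄₃ ∩ ker ρ̄₅ ∩ sqrtFixer(−1) ∩ sqrtFixer(λ) ∩ sqrtFixer(λ−1))] ≤ |GL₂(𝔽₃)|·|GL₂(𝔽₅)|·1·2 = 46080`
  (abc-iut-L5-t7's `gens_fixed_of_mem`, `index_fixingSubgroup_adjoin_sqrtSet_dvd_two`; abc-iut-S5's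
  `index_ker_galoisRepTorsion_dvd`).

This is the per-place input `hbig`/`hFbig` of abc-iut-S1's `PlaceSection.R4_localFieldFamily_abs` /
`R4_localFieldFamily_param` (GenuineRamificationBounds, appendices) for the v3 datum with PRINT's constant
`e*_mod = 2^12·3^3·5·e_mod` (`e(w | v_mod) ≤ 46080·[F_tpd : F_mod] ≤ 2^11·3^3·5`). Proof-only (no definition, no named fact);
classical; TAKES NO SIDE on [IUTchIII] Cor. 3.12.
-/

noncomputable section

open scoped Classical

namespace Literature.IUT.LogVolume

namespace Cor22

open NumberField IsDedekindDomain Literature.NumberTheory.DiophantineGeometry.GenEll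
open Literature.NumberTheory.EllipticCurves Literature.NumberTheory.GaloisRepresentations
open Literature.NumberTheory.NumberFields WeierstrassCurve IntermediateField Field

variable (P : NFPoint)

/-! ## Square-root fixers: `√(ab)` and `√a` fixed ⇒ `√b` fixed -/

/-- If `τ ∈ Gal(F̄_tpd/F_tpd)` fixes every square root of `a·b` and every square root of `a ≠ 0`, then it fixes every
square root of `b` (`z² = b`, `z₁² = a` ⇒ `(z·z₁)² = ab`). [cite: MilneFT2022, Ch. 5 (Kummer theory: the polynomial X² − a)] -/
theorem sqrtFixer_mul_inf_le {a b : P.F} (ha : a ≠ 0) :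
    sqrtFixer P (a * b) ⊓ sqrtFixer P a ≤ sqrtFixer P b := by
  intro τ hτ
  obtain ⟨z₁, hz₁⟩ : ∃ z₁ : AlgebraicClosure P.F, z₁ ^ 2 = algebraMap P.F _ a :=
    IsAlgClosed.exists_pow_nat_eq _ two_pos
  have hz₁0 : z₁ ≠ 0 := by
    intro h; rw [h, zero_pow two_ne_zero] at hz₁
    exact ha ((map_eq_zero_iff _ (algebraMap P.F (AlgebraicClosure P.F)).injective).mp hz₁.symm)
  refine mem_fixingSubgroup_adjoin_of_forall_eq (σ := Field.absoluteGaloisGroup.toAlgEquiv P.F τ) fun z hz => ?_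
  have hz : z ^ 2 = algebraMap P.F _ b := hz
  have hprod : (z * z₁) ^ 2 = algebraMap P.F _ (a * b) := by rw [mul_pow, hz, hz₁, map_mul, mul_comm]
  have h1 : (Field.absoluteGaloisGroup.toAlgEquiv P.F τ) (z * z₁) = z * z₁ :=
    forall_eq_of_mem_fixingSubgroup_adjoin hτ.1 _ hprod
  have h2 : (Field.absoluteGaloisGroup.toAlgEquiv P.F τ) z₁ = z₁ :=
    forall_eq_of_mem_fixingSubgroup_adjoin hτ.2 _ hz₁
  rw [map_mul, h2] at h1
  exact mul_right_cancel₀ hz₁0 h1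

/-- `sqrtFixer a` has index `≤ 2` in any subgroup `A` (`[F_tpd(√a) : F_tpd] ∣ 2`, normal).
[cite: MilneFT2022, Ch. 5 (Kummer theory: the polynomial X² − a)] -/
theorem relIndex_sqrtFixer_le_two (a : P.F) (A : Subgroup (absoluteGaloisGroup P.F)) :
    (sqrtFixer P a).relIndex A ≤ 2 := by
  haveI : IsGalois P.F (adjoin P.F {z : AlgebraicClosure P.F | z ^ 2 = algebraMap P.F _ a}) := isGalois_adjoin_sqrtSet _
  haveI : (sqrtFixer P a).Normal := IsGalois.fixingSubgroup_normal_of_isGalois _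
  have h2 : (sqrtFixer P a).index ∣ 2 := index_fixingSubgroup_adjoin_sqrtSet_dvd_two a
  exact (Nat.le_of_dvd (Nat.pos_of_ne_zero fun h => by simp [h] at h2)
    (Subgroup.relIndex_dvd_index_of_normal (sqrtFixer P a) A)).trans (Nat.le_of_dvd two_pos h2)

/-- **The pair of twist fixers has index `≤ 2` in any `A ≤ sqrtFixer c`, `c ∈ {λ, λ−1, λ(λ−1)}`** (`λ ≠ 0`): one of the
two fixers contains `A` or is cut out inside `A` by the other (`√(λ−1) = √(λ(λ−1))/√λ`).
[cite: Mochizuki2012, IUTchIV Thm 1.10 proof Step (ii) p.24] -/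
theorem relIndex_sqrtFixer_inf_le_two (hx : P.x ≠ 0) {c : P.F}
    (hc : c ∈ ({P.x, P.x - 1, P.x * (P.x - 1)} : Set P.F)) (A : Subgroup (absoluteGaloisGroup P.F))
    (hA : A ≤ sqrtFixer P c) :
    (sqrtFixer P P.x ⊓ sqrtFixer P (P.x - 1)).relIndex A ≤ 2 := by
  simp only [Set.mem_insert_iff, Set.mem_singleton_iff] at hc
  rcases hc with rfl | rfl | rfl
  · -- `c = λ`: `A ≤ sqrtFixer λ`, so the pair's trace on `A` is that of `sqrtFixer (λ−1)`
    have h : sqrtFixer P P.x ⊓ sqrtFixer P (P.x - 1) ⊓ A = sqrtFixer P (P.x - 1) ⊓ A :=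
      le_antisymm (inf_le_inf_right A inf_le_right)
        (le_inf (le_inf ((inf_le_right).trans hA) inf_le_left) inf_le_right)
    rw [← Subgroup.inf_relIndex_right, h, Subgroup.inf_relIndex_right]
    exact relIndex_sqrtFixer_le_two P _ A
  · -- `c = λ − 1`
    have h : sqrtFixer P P.x ⊓ sqrtFixer P (P.x - 1) ⊓ A = sqrtFixer P P.x ⊓ A :=
      le_antisymm (inf_le_inf_right A inf_le_left)
        (le_inf (le_inf inf_le_left ((inf_le_right).trans hA)) inf_le_right)
    rw [← Subgroup.inf_relIndex_right, h, Subgroup.inf_relIndex_right]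
    exact relIndex_sqrtFixer_le_two P _ A
  · -- `c = λ(λ−1)`: inside `A ≤ sqrtFixer (λ(λ−1))`, `sqrtFixer λ ≤ sqrtFixer (λ−1)`
    have hle : sqrtFixer P P.x ⊓ A ≤ sqrtFixer P (P.x - 1) := fun τ hτ =>
      sqrtFixer_mul_inf_le P hx ⟨hA hτ.2, hτ.1⟩
    have h : sqrtFixer P P.x ⊓ sqrtFixer P (P.x - 1) ⊓ A = sqrtFixer P P.x ⊓ A :=
      le_antisymm (inf_le_inf_right A inf_le_left)
        (le_inf (le_inf inf_le_left hle) inf_le_right)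
    rw [← Subgroup.inf_relIndex_right, h, Subgroup.inf_relIndex_right]
    exact relIndex_sqrtFixer_le_two P _ A

/-! ## The bound -/

variable {P} (F : Type) [Field F] [NumberField F] [Algebra P.F F]

/-- **`e(w | v) ≤ 46080` for every place `w` of a field pinned by `IsSubThetaField P F` (Galois over `F_tpd`) over a
place `v ∤ 2` of `F_tpd`** — print's Step (ii)/(iii) budget `[F : F_tpd] ≤ 2·|GL₂(𝔽₃)|·|GL₂(𝔽₅)|` for the layer
`F/F_tpd`, recovered for the cell's reading v3 (`F ⊆ F_tpd(√−1, √λ, √(λ−1), E_λ[15])`, degree up to `2²·46080`) at odd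
places from the inertia group: it fixes `√−1` and the even-order twist root, leaving `ker ρ̄₃ ∩ ker ρ̄₅ ∩` one twist fixer.
[cite: Mochizuki2012, IUTchIV Thm 1.10 proof Step (ii) p.24] [cite: Mochizuki2012, IUTchIV Thm 1.10 proof Step (iii) (R2)–(R4) p.25–26] -/
theorem ramificationIdx_subThetaField_le (hU : P.InU) (hF : IsSubThetaField P F) [IsGalois P.F F]
    (w : HeightOneSpectrum (𝓞 F)) (h2 : ((2 : ℕ) : 𝓞 P.F) ∉ (finBelow P.F F w).asIdeal) :
    w.asIdeal.ramificationIdx (𝓞 P.F) ≤ 46080 := by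
  haveI : P.legendreCurve.IsElliptic := P.legendreCurve_isElliptic_iff.2 hU
  haveI : Fact (Nat.Prime 3) := ⟨Nat.prime_three⟩
  haveI : Fact (Nat.Prime 5) := ⟨Nat.prime_five⟩
  set v := finBelow P.F F w with hvdef
  -- `F ≃ L := F_tpd(φ S) ⊆ F̄_tpd`
  haveI : FiniteDimensional P.F F := Module.Finite.of_restrictScalars_finite ℚ P.F F
  set Ω := AlgebraicClosure P.F
  let φ : F →ₐ[P.F] Ω := IsAlgClosed.lift
  set S : Set F := subThetaFieldGenerators P F with hSdef
  set L : IntermediateField P.F Ω := IntermediateField.adjoin P.F (φ '' S) with hLdef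
  have hL : φ.fieldRange = L := by
    rw [AlgHom.fieldRange_eq_map, ← hF.adjoin_eq_top, IntermediateField.adjoin_map]
  let e : F ≃ₐ[P.F] L :=
    (((IntermediateField.topEquiv (F := P.F) (E := F)).symm.trans (IntermediateField.equivMap ⊤ φ)).trans
      (IntermediateField.equivOfEq (AlgHom.fieldRange_eq_map φ).symm)).trans
      (IntermediateField.equivOfEq hL)
  haveI : FiniteDimensional P.F L := LinearEquiv.finiteDimensional e.toLinearEquiv
  haveI : IsGalois P.F L := IsGalois.of_algEquiv e
  haveI : NumberField L := NumberField.of_module_finite P.F L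
  -- absolute inertia at `v`
  obtain ⟨𝔓, h𝔓⟩ := HeightOneSpectrum.primesAbove_nonempty v
  haveI : 𝔓.IsPrime := h𝔓.1
  haveI : 𝔓.LiesOver v.asIdeal := h𝔓.2
  set I : Subgroup (absoluteGaloisGroup P.F) := 𝔓.inertia (absoluteGaloisGroup P.F) with hIdef
  -- the even-order twist radicand `c` at `v`
  obtain ⟨c, hc, k, hck⟩ := exists_valuation_eq_exp_two_mul v hU.1
  have h2' : (2 : 𝓞 P.F) ∉ v.asIdeal := by exact_mod_cast h2
  have h4 : ((4 : ℕ) : 𝓞 P.F) ∉ v.asIdeal := by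
    intro h
    haveI := v.isPrime
    have : ((2 : ℕ) : 𝓞 P.F) * ((2 : ℕ) : 𝓞 P.F) ∈ v.asIdeal := by
      rw [← Nat.cast_mul]; exact h
    rcases (Ideal.IsPrime.mem_or_mem inferInstance this) with h' | h' <;> exact h2 h'
  -- (1) `I ≤ A := sqrtFixer(−1) ⊓ sqrtFixer(c)`
  set A : Subgroup (absoluteGaloisGroup P.F) := sqrtFixer P (-1) ⊓ sqrtFixer P c with hAdef
  have hIA : I ≤ A := by
    intro σ hσ
    refine ⟨mem_fixingSubgroup_adjoin_of_forall_eq (σ := Field.absoluteGaloisGroup.toAlgEquiv P.F σ)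
        fun z hz => ?_,
      mem_fixingSubgroup_adjoin_of_forall_eq (σ := Field.absoluteGaloisGroup.toAlgEquiv P.F σ) fun z hz => ?_⟩
    · -- `z² = −1`: `z⁴ = 1`
      have hz : z ^ 2 = algebraMap P.F Ω (-1) := hz
      have hz4 : z ^ 4 = 1 := by
        rw [show (4 : ℕ) = 2 * 2 by norm_num, pow_mul, hz, map_neg, map_one]; norm_num
      exact smul_eq_of_mem_inertia_of_pow_eq_one v h𝔓 hσ h4 hz4
    · -- `z² = c`, `c` of even `v`-order
      exact smul_eq_of_mem_inertia_of_sq_eq_of_valuation_eq_exp_even v h𝔓 hσ h2' hck hz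
  -- (2) the gens-fixer `H ≤ Gal(F̄_tpd/L)`
  set K3 : Subgroup (absoluteGaloisGroup P.F) := (P.legendreCurve.galoisRepTorsion ((3 : ℕ) : ℤ)).ker with hK3
  set K5 : Subgroup (absoluteGaloisGroup P.F) := (P.legendreCurve.galoisRepTorsion ((5 : ℕ) : ℤ)).ker with hK5
  haveI : K3.Normal := MonoidHom.normal_ker _
  haveI : K5.Normal := MonoidHom.normal_ker _
  set H : Subgroup (absoluteGaloisGroup P.F) :=
    K3 ⊓ K5 ⊓ (sqrtFixer P (-1) ⊓ (sqrtFixer P P.x ⊓ sqrtFixer P (P.x - 1))) with hHdef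
  have hHN : H ≤ L.fixingSubgroup := by
    intro τ hτ
    refine mem_fixingSubgroup_adjoin_of_forall_eq (σ := Field.absoluteGaloisGroup.toAlgEquiv P.F τ) fun s hs => ?_
    obtain ⟨x, hx, rfl⟩ := hs
    rcases hx with (hsq | hsq | hsq) | htor
    · -- `x² = −1`
      have : (φ x) ^ 2 = algebraMap P.F Ω (-1) := by rw [← map_pow, hsq, map_neg, map_one, map_neg, map_one]
      exact forall_eq_of_mem_fixingSubgroup_adjoin hτ.2.1 _ this
    · -- `x² = λ`
      have : (φ x) ^ 2 = algebraMap P.F Ω P.x := by rw [← map_pow, hsq, φ.commutes]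
      exact forall_eq_of_mem_fixingSubgroup_adjoin hτ.2.2.1 _ this
    · -- `x² = λ − 1`
      have : (φ x) ^ 2 = algebraMap P.F Ω (P.x - 1) := by
        rw [← map_pow, hsq, map_sub, map_one, φ.commutes, map_sub, map_one]
      exact forall_eq_of_mem_fixingSubgroup_adjoin hτ.2.2.2 _ this
    · -- a `15`-torsion coordinate: transport the point to `E_λ(F̄_tpd)`
      rw [torsionCoords_eq] at htor
      obtain ⟨T, hT, hxT⟩ := Set.mem_iUnion₂.1 htor
      have hT15 : (15 : ℤ) • T = 0 := hT
      let T' : geomPoints P.legendreCurve := Affine.Point.map (W' := P.legendreCurve.toAffine) φ T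
      have hT' : (15 : ℤ) • T' = 0 := by
        change (15 : ℤ) • Affine.Point.map (W' := P.legendreCurve.toAffine) φ T = 0
        rw [← map_zsmul, hT15, map_zero]
      have h3' : ∀ Q : geomTorsion P.legendreCurve ((3 : ℕ) : ℤ), τ • Q = Q := by
        intro Q
        have hQ := galoisRepTorsion_apply P.legendreCurve ((3 : ℕ) : ℤ) τ Q
        rw [(MonoidHom.mem_ker).1 hτ.1.1] at hQ
        exact hQ.symm
      have h5' : ∀ Q : geomTorsion P.legendreCurve ((5 : ℕ) : ℤ), τ • Q = Q := by
        intro Q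
        have hQ := galoisRepTorsion_apply P.legendreCurve ((5 : ℕ) : ℤ) τ Q
        rw [(MonoidHom.mem_ker).1 hτ.1.2] at hQ
        exact hQ.symm
      have hfix : τ • T' = T' := smul_eq_of_fifteen τ h3' h5' T' hT'
      refine forall_coords_of_smul_eq P τ T' hfix (φ x) ?_
      rcases T with _ | ⟨a, b, hab⟩
      · simp [pointCoords] at hxT
      · change φ x ∈ pointCoords (Affine.Point.map (W' := P.legendreCurve.toAffine) φ
          (Affine.Point.some a b hab))
        rw [Affine.Point.map_some]
        simp only [pointCoords, Set.mem_insert_iff, Set.mem_singleton_iff] at hxT ⊢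
        rcases hxT with rfl | rfl
        · exact Or.inl rfl
        · exact Or.inr rfl
  -- (3) index bookkeeping: `[A : A ∩ Gal(F̄/L)] ≤ [A : A ∩ H] ≤ 48 · 480 · (1 · 2)`
  have hK3d : K3.index ∣ 3 * (3 - 1) ^ 2 * (3 + 1) := P.legendreCurve.index_ker_galoisRepTorsion_dvd 3
  have hK5d : K5.index ∣ 5 * (5 - 1) ^ 2 * (5 + 1) := P.legendreCurve.index_ker_galoisRepTorsion_dvd 5
  have e48 : (3 * (3 - 1) ^ 2 * (3 + 1) : ℕ) = 48 := by norm_num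
  have e480 : (5 * (5 - 1) ^ 2 * (5 + 1) : ℕ) = 480 := by norm_num
  rw [e48] at hK3d
  rw [e480] at hK5d
  have i4 : K3.index ≠ 0 := fun h => by rw [h] at hK3d; exact absurd (zero_dvd_iff.mp hK3d) (by norm_num)
  have i5 : K5.index ≠ 0 := fun h => by rw [h] at hK5d; exact absurd (zero_dvd_iff.mp hK5d) (by norm_num)
  have hK3r : K3.relIndex A ≤ 48 :=
    (Nat.le_of_dvd (Nat.pos_of_ne_zero i4) (Subgroup.relIndex_dvd_index_of_normal K3 A)).trans
      (Nat.le_of_dvd (by norm_num) hK3d)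
  have hK5r : K5.relIndex A ≤ 480 :=
    (Nat.le_of_dvd (Nat.pos_of_ne_zero i5) (Subgroup.relIndex_dvd_index_of_normal K5 A)).trans
      (Nat.le_of_dvd (by norm_num) hK5d)
  have hS1 : (sqrtFixer P (-1)).relIndex A = 1 := Subgroup.relIndex_eq_one.mpr inf_le_left
  have hS2 : (sqrtFixer P P.x ⊓ sqrtFixer P (P.x - 1)).relIndex A ≤ 2 :=
    relIndex_sqrtFixer_inf_le_two P hU.1 hc A inf_le_right
  have hHr : H.relIndex A ≤ 46080 := by
    calc H.relIndex A ≤ (K3 ⊓ K5).relIndex A *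
          (sqrtFixer P (-1) ⊓ (sqrtFixer P P.x ⊓ sqrtFixer P (P.x - 1))).relIndex A := Subgroup.relIndex_inf_le
      _ ≤ (K3.relIndex A * K5.relIndex A) *
          ((sqrtFixer P (-1)).relIndex A * (sqrtFixer P P.x ⊓ sqrtFixer P (P.x - 1)).relIndex A) :=
            Nat.mul_le_mul Subgroup.relIndex_inf_le Subgroup.relIndex_inf_le
      _ ≤ (48 * 480) * (1 * 2) := by
            rw [hS1]; exact Nat.mul_le_mul (Nat.mul_le_mul hK3r hK5r) (Nat.mul_le_mul le_rfl hS2)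
      _ = 46080 := by norm_num
  have hHr0 : H.relIndex A ≠ 0 := by
    -- `H ⊓ A` has finite index: `[A : H ⊓ A] · [Γ : A] = [Γ : H ⊓ A] ≠ 0`
    have i1 : (sqrtFixer P (-1)).index ≠ 0 := fun h => by
      have := index_fixingSubgroup_adjoin_sqrtSet_dvd_two (K := P.F) (-1 : P.F)
      rw [show (adjoin P.F {z : AlgebraicClosure P.F | z ^ 2 = algebraMap P.F _ (-1 : P.F)}).fixingSubgroup.index
        = 0 from h] at this
      exact absurd (zero_dvd_iff.mp this) two_ne_zero
    have i2 : (sqrtFixer P c).index ≠ 0 := fun h => by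
      have := index_fixingSubgroup_adjoin_sqrtSet_dvd_two (K := P.F) c
      rw [show (adjoin P.F {z : AlgebraicClosure P.F | z ^ 2 = algebraMap P.F _ c}).fixingSubgroup.index
        = 0 from h] at this
      exact absurd (zero_dvd_iff.mp this) two_ne_zero
    have i2' : (sqrtFixer P P.x).index ≠ 0 := fun h => by
      have := index_fixingSubgroup_adjoin_sqrtSet_dvd_two (K := P.F) P.x
      rw [show (adjoin P.F {z : AlgebraicClosure P.F | z ^ 2 = algebraMap P.F _ P.x}).fixingSubgroup.index
        = 0 from h] at this
      exact absurd (zero_dvd_iff.mp this) two_ne_zero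
    have i3 : (sqrtFixer P (P.x - 1)).index ≠ 0 := fun h => by
      have := index_fixingSubgroup_adjoin_sqrtSet_dvd_two (K := P.F) (P.x - 1)
      rw [show (adjoin P.F {z : AlgebraicClosure P.F | z ^ 2 = algebraMap P.F _ (P.x - 1)}).fixingSubgroup.index
        = 0 from h] at this
      exact absurd (zero_dvd_iff.mp this) two_ne_zero
    have hH : H.index ≠ 0 :=
      Subgroup.index_inf_ne_zero (Subgroup.index_inf_ne_zero i4 i5)
        (Subgroup.index_inf_ne_zero i1 (Subgroup.index_inf_ne_zero i2' i3))
    have hA : A.index ≠ 0 := Subgroup.index_inf_ne_zero i1 i2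
    have hHA : (H ⊓ A).index ≠ 0 := Subgroup.index_inf_ne_zero hH hA
    have hmul : (H ⊓ A).relIndex A * A.index = (H ⊓ A).index := Subgroup.relIndex_mul_index inf_le_right
    rw [Subgroup.inf_relIndex_right] at hmul
    intro h0
    rw [h0, zero_mul] at hmul
    exact hHA hmul.symm
  -- (4) `e(w | v)`, read on the inertia group of `Gal(L/F_tpd)`, is at most `[A : A ∩ Gal(F̄/L)]`
  set Q : Ideal (𝓞 L) := w.asIdeal.map (RingOfIntegers.mapAlgEquiv e : 𝓞 F ≃ₐ[𝓞 P.F] 𝓞 L) with hQ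
  haveI : Q.IsPrime := isPrime_map_mapAlgEquiv e w
  haveI : Q.LiesOver v.asIdeal := liesOver_map_mapAlgEquiv e w _
  rw [← ramificationIdx_map_mapAlgEquiv e w]
  set r : absoluteGaloisGroup P.F →* (L ≃ₐ[P.F] L) := AlgEquiv.restrictNormalHom L with hr
  have hker : r.ker = L.fixingSubgroup := IntermediateField.restrictNormalHom_ker L
  have h1 : (𝔓.comap (ringOfIntegersToIntegralClosure (k := P.F) (Ω := Ω) L)).inertia (L ≃ₐ[P.F] L) ≤
      A.map r := by
    intro g hg
    obtain ⟨σ, hσ, hσg⟩ := @exists_mem_inertia_restrict_eq P.F _ _ L _ _ 𝔓 h𝔓.1 g hg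
    refine ⟨σ, hIA hσ, AlgEquiv.ext fun x => Subtype.ext ?_⟩
    change (algebraMap L Ω) ((σ.restrictNormal L) x) = (algebraMap L Ω) (g x)
    rw [AlgEquiv.restrictNormal_commutes]
    exact hσg x
  -- `[A : A ∩ Gal(F̄/L)]` is finite and positive
  have hN0 : L.fixingSubgroup.relIndex A ≠ 0 := by
    have hN : L.fixingSubgroup.index ≠ 0 := by
      rw [← IntermediateField.finrank_eq_fixingSubgroup_index]; exact Module.finrank_pos.ne'
    have i1 : (sqrtFixer P (-1)).index ≠ 0 := fun h => by
      have := index_fixingSubgroup_adjoin_sqrtSet_dvd_two (K := P.F) (-1 : P.F)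
      rw [show (adjoin P.F {z : AlgebraicClosure P.F | z ^ 2 = algebraMap P.F _ (-1 : P.F)}).fixingSubgroup.index
        = 0 from h] at this
      exact absurd (zero_dvd_iff.mp this) two_ne_zero
    have i2 : (sqrtFixer P c).index ≠ 0 := fun h => by
      have := index_fixingSubgroup_adjoin_sqrtSet_dvd_two (K := P.F) c
      rw [show (adjoin P.F {z : AlgebraicClosure P.F | z ^ 2 = algebraMap P.F _ c}).fixingSubgroup.index
        = 0 from h] at this
      exact absurd (zero_dvd_iff.mp this) two_ne_zero
    have hA : A.index ≠ 0 := Subgroup.index_inf_ne_zero i1 i2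
    have hNA : (L.fixingSubgroup ⊓ A).index ≠ 0 := Subgroup.index_inf_ne_zero hN hA
    have hmul : (L.fixingSubgroup ⊓ A).relIndex A * A.index = (L.fixingSubgroup ⊓ A).index :=
      Subgroup.relIndex_mul_index inf_le_right
    rw [Subgroup.inf_relIndex_right] at hmul
    intro h0
    rw [h0, zero_mul] at hmul
    exact hNA hmul.symm
  have key : Q.ramificationIdx (𝓞 P.F) ≤ 46080 := by
    rw [@ramificationIdx_eq_card_inertia_comap P.F _ _ L _ _ v 𝔓 h𝔓.1 h𝔓.2 Q _ _]
    have hdvd : Nat.card ((𝔓.comap (ringOfIntegersToIntegralClosure (k := P.F) (Ω := Ω) L)).inertia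
        (L ≃ₐ[P.F] L)) ∣ L.fixingSubgroup.relIndex A := by
      have h := Subgroup.card_dvd_of_le h1
      rwa [← Subgroup.relIndex_ker A r, hker] at h
    calc Nat.card ((𝔓.comap (ringOfIntegersToIntegralClosure (k := P.F) (Ω := Ω) L)).inertia (L ≃ₐ[P.F] L))
        ≤ L.fixingSubgroup.relIndex A := Nat.le_of_dvd (Nat.pos_of_ne_zero hN0) hdvd
      _ ≤ H.relIndex A := Nat.le_of_dvd (Nat.pos_of_ne_zero hHr0) (Subgroup.relIndex_dvd_of_le_left A hHN)
      _ ≤ 46080 := hHr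
  exact key

end Cor22

end Literature.IUT.LogVolume

end
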